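import Summits.QuantumFields.YangMills.Theorems.FluctuationComparisonRegPrIntLOrganTangentFibreMeanTransport
import HarnessLib

/-!
# Crux `FluctuationComparisonRegPrIntL` (stmt-QuantumFields-20520, rung R3), PATH-B organ, v18 (H-currency) — (L22) THE CHART REPRESENTATION OF THE σ-FIBRE MEAN:
# (L16)'s (A)-package with the chart integrals EXPLICIT, and (hrep) «`mfun V = (∫ J·a∘Φ dτ)∕(∫ J·b∘Φ dτ)` at EVERY window point» for LINᵘ-H′'s `(σ, mfun)`

Cell `ym3-torus` (YM ladder rung R3 = continuum `SU(2)` Yang–Mills on the three-torus — a RUNG: NOT d = 4, NOT infinite volume, NOT a mass gap, NOT Clay).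
Width seat `ym-ust-20520-w5` (gen 23), `--supports stmt-QuantumFields-20520 --as helper`, count-neutral, no registry ∕ binder ∕ `Lines/` edit, DEFINITION-FREE,
default heartbeats.  LEAD w3 g25 №28: the LIN knit scratch `Cruxes/…/LinKnit_LEAD_w3g25.lean` v0.1 type-checks modulo two steps, (hrep) and (hInt); this file
closes (hrep) BY NAME.  Re-cut of my lineage's ✓(L16) `…OrganTangentAPackageDescendTo.regularPackage_descendTo_of_fibredChart` (w5 g22), whose (A)-package keeps
the fibre measure `lam V = (τ.withDensity J(V,·)).map Φ(V,·)` ∃-bound (abstract by design, for KNIT∕VERᵐ); the knit needs its body.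

* §1 ★★`chartIntegrals_descendTo_of_fibredChart` — data VERBATIM as ✓(L16) (ANY Markov `bind`-disintegration `σ₀` of `dU_K` along `descendTo F ℰp j K` = LINᵘ-H′'s
  three σ-binders; the fibred-chart letters `hmap`∕`havgΦ`∕`hS`∕(C1′) `hint`∕`hJB`∕`B` of ✓(L15-MW) = SpreadFibreLawH v0.3i's chart block) minus the (C3) mass letter;
  conclusion (A1′) window-continuity of `V ↦ ∫ J(V,z)·f(Φ(V,z)) dτ` and (A3′) `∃ c, … ∀ᵐ V ∂(descendTo_* dU_K), window → 0 < c V ∧ ∫ f ∂(σ₀ V) = c V·∫ J(V,z)·f(Φ(V,z)) dτ`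
  for continuous `f` vanishing off MW — (L16)'s proof with the package body kept in the statement.
* §2 ★★★`mfun_eq_chartRatio_on_window` — (hrep): `∀ V, PlaqSmall θ_j V → mfun V = (∫ J·a∘Φ(V,·) dτ)∕(∫ J·b∘Φ(V,·) dτ)` from the `(σ, mfun)` antecedent
  (`mfun` window-continuous, `= (∫ a ∂σ V)∕(∫ b ∂σ V)` `dU_j`-a.e. on the window), §1, continuous `a b` vanishing off MW with `b ≥ 0`, `b > 0` on MW (knit:
  `a = χ_{j,Ts}·h_{Ts}·ρ′_{Ts}`, `b = χ_{j,Ts}·ρ′_{Ts}`, continuous by ✓TOOLS `continuous_mul_of_tsupport_subset`), the (C3) mass letter, and the cut tower's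
  consistency data `(mY ≪ dU_K, mY.map d = rj·dU_j, rj > 0 on the window)` — the `c V` cancels, the chart denominator is positive, `descendTo_* dU_K`-a.e. →
  `dU_j`-a.e. on the window by ✓KNIT `ae_on_of_ae_map_of_ac_of_map_eq`, and EVERY window point by ✓(L21b) `eq_on_window_of_ae` ((A1′) + positivity give the
  chart ratio's window-continuity).  With `wgt₀(V,z) := J·b∘Φ ∕ ∫ J·b∘Φ dτ` the right side is `∫ (h∘Φ(V,·))·wgt₀(V,·) dτ` after `integral_div` (knit-side).

HONEST FRAMING: disintegration ∕ dominated-convergence plumbing over landed kernel facts (Node00 fibre-integral lemmas, KNIT transfer, (L21b)); nothing of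
Bałaban's analysis is asserted or proved; SpreadFibreLawH ∕ LIN″ ∕ O1ᵘ-H v2.x ∕ S1aᴴ ∕ 26243 ∕ S2α′ ∕ S2β OPEN; crux 20520 `FluctuationComparisonRegPrIntL` ∕ `YM3TorusSU2`
NOT proved; no summit ∕ sub-problem statement is proved; registry untouched; rung R3 = SU(2) YM₃ on T³ at fixed lattice data — NOT d = 4, NOT infinite volume, NOT a
mass gap, NOT Clay; the Yang–Mills mass gap is NOT proved.  [folklore] measure theory; citations are bookkeeping locators.
-/

set_option autoImplicit false

noncomputable section

namespace Summit.QuantumFields.YangMills.Theorems.OrganTangentChartRepresentation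

open MeasureTheory ProbabilityTheory Filter Topology Set Function
open scoped ENNReal NNReal
open Literature.MathematicalPhysics.QuantumFieldTheory.Balaban1983to89
open T3ContinuumYM3Torus T3NestedUnitLaws T3UnitLawDensityEML T3UnitScaleTilt T3LevelShift T3TiltDescent T4Continuum
open Literature.MathematicalPhysics.QuantumFieldTheory.Balaban1983to89.T3OrbitAverage
open Literature.MathematicalPhysics.QuantumFieldTheory.Balaban1983to89.T3DescentFibreTower (descendTo_descendTo descendTo_self)
open Summit.QuantumFields.YangMills.Theorems.OrganTangentFibreMeanTools
open Summit.QuantumFields.YangMills.Theorems.FluctuationComparisonRegPrIntLOrganTangentAPackageDescendTo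
  (measurableSet_multiWindow absolutelyContinuous_map_descendTo)

/-! ## §1 The chart integrals of a disintegration, EXPLICIT ((L16)'s (A1)∕(A3) with the fibre package's body in the statement) -/

/-- ★★ **THE CHART INTEGRALS OF A DISINTEGRATION — EXPLICIT EDITION OF ✓(L16) `regularPackage_descendTo_of_fibredChart`.**  Same data VERBATIM (ANY Markov
`bind`-disintegration `σ₀` of `dU_K` along `descendTo F ℰp j K` — LINᵘ-H′'s three σ-binders — and the fibred-chart letters of ✓(L15-MW) ∕ SpreadFibreLawH's chart
block: `hmap` identity, `havgΦ`, `hS`, (C1′) `hint`, `hJB`∕`B`), minus the (C3) mass letter; conclusion with the chart integrals IN THE STATEMENT: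
(A1′) `V ↦ ∫ J(V,z)·f(Φ(V,z)) dτ` is continuous on the window for continuous `f` supported in MW; (A3′) `∃ c`, for continuous `f` vanishing off MW:
`∀ᵐ V ∂(descendTo_* dU_K), PlaqSmall θ_j V → 0 < c V ∧ ∫ f ∂(σ₀ V) = c V · ∫ J(V,z)·f(Φ(V,z)) dτ`.  (In ✓(L16) the same holds with `∫ f ∂(lam V)` for an
∃-bound `lam` whose body `(τ.withDensity J(V,·)).map Φ(V,·)` stays inside the proof; this re-cut exports it — the proof is (L16)'s, verbatim where possible.)
[cite: Balaban1987RG1, (0.11) p.253 and (2.10) p.267; Balaban1985Averaging, (10)-(13) p.19; Balaban1985UV3, (7) p.257] -/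
theorem chartIntegrals_descendTo_of_fibredChart
    (F : T3Family) (γ b₀ p₀ : ℝ) (j K : ℕ) (hjK : j ≤ K)
    (σ₀ : Kernel (GaugeField (F.P j) 0 ↥(Matrix.specialUnitaryGroup (Fin 2) ℂ))
      (GaugeField (F.P K) 0 ↥(Matrix.specialUnitaryGroup (Fin 2) ℂ)))
    (hσ₀M : IsMarkovKernel σ₀)
    (hbind₀ : (Measure.map (descendTo F ℰp j K hjK) (fieldMeasure (F.P K) 0 ↥(Matrix.specialUnitaryGroup (Fin 2) ℂ))).bind ⇑σ₀ =
      fieldMeasure (F.P K) 0 ↥(Matrix.specialUnitaryGroup (Fin 2) ℂ))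
    (hfib₀ : ∀ᵐ V ∂(Measure.map (descendTo F ℰp j K hjK) (fieldMeasure (F.P K) 0 ↥(Matrix.specialUnitaryGroup (Fin 2) ℂ))),
      ∀ᵐ U ∂(σ₀ V), descendTo F ℰp j K hjK U = V)
    {Z : Type*} [MeasurableSpace Z] (τ : Measure Z) [SFinite τ]
    (Φ : GaugeField (F.P j) 0 ↥(Matrix.specialUnitaryGroup (Fin 2) ℂ) × Z → GaugeField (F.P K) 0 ↥(Matrix.specialUnitaryGroup (Fin 2) ℂ))
    (hΦ : Measurable Φ)
    (J : GaugeField (F.P j) 0 ↥(Matrix.specialUnitaryGroup (Fin 2) ℂ) × Z → ℝ≥0) (hJ : Measurable J)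
    (S : Set (GaugeField (F.P K) 0 ↥(Matrix.specialUnitaryGroup (Fin 2) ℂ)))
    (hS : ∀ U, (∀ (n : ℕ) (hjn : j + 1 ≤ n) (hnK : n ≤ K), PlaqSmall (24 / 25 * θBal F.L γ b₀ p₀ n) (descendTo F ℰp n K hnK U)) → U ∈ S)
    (havgΦ : ∀ V ∈ {V | PlaqSmall (θBal F.L γ b₀ p₀ j) V}, ∀ z, descendTo F ℰp j K hjK (Φ (V, z)) = V)
    (hmap : (fieldMeasure (F.P K) 0 ↥(Matrix.specialUnitaryGroup (Fin 2) ℂ)).restrict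
        (descendTo F ℰp j K hjK ⁻¹' {V | PlaqSmall (θBal F.L γ b₀ p₀ j) V} ∩ S) =
      ((((fieldMeasure (F.P j) 0 ↥(Matrix.specialUnitaryGroup (Fin 2) ℂ)).restrict {V | PlaqSmall (θBal F.L γ b₀ p₀ j) V}).prod τ).withDensity
        (fun p => (J p : ℝ≥0∞))).map Φ)
    (hint : ∀ f : GaugeField (F.P K) 0 ↥(Matrix.specialUnitaryGroup (Fin 2) ℂ) → ℝ, Continuous f →
      (∀ U, f U ≠ 0 → ∀ (n : ℕ) (hjn : j + 1 ≤ n) (hnK : n ≤ K), PlaqSmall (24 / 25 * θBal F.L γ b₀ p₀ n) (descendTo F ℰp n K hnK U)) →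
      ∀ᵐ z ∂τ, ContinuousOn (fun V => (J (V, z) : ℝ) * f (Φ (V, z))) {V | PlaqSmall (θBal F.L γ b₀ p₀ j) V})
    (B : Z → ℝ) (hB : Integrable B τ)
    (hJB : ∀ V, PlaqSmall (θBal F.L γ b₀ p₀ j) V → ∀ᵐ z ∂τ, (J (V, z) : ℝ) ≤ B z) :
    (∀ f : GaugeField (F.P K) 0 ↥(Matrix.specialUnitaryGroup (Fin 2) ℂ) → ℝ, Continuous f →
        (∀ U, f U ≠ 0 → ∀ (n : ℕ) (hjn : j + 1 ≤ n) (hnK : n ≤ K), PlaqSmall (24 / 25 * θBal F.L γ b₀ p₀ n) (descendTo F ℰp n K hnK U)) →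
        ContinuousOn (fun V => ∫ z, (J (V, z) : ℝ) * f (Φ (V, z)) ∂τ) {V | PlaqSmall (θBal F.L γ b₀ p₀ j) V}) ∧
      (∃ c : GaugeField (F.P j) 0 ↥(Matrix.specialUnitaryGroup (Fin 2) ℂ) → ℝ,
        ∀ f : GaugeField (F.P K) 0 ↥(Matrix.specialUnitaryGroup (Fin 2) ℂ) → ℝ, Continuous f →
          (∀ U, ¬ (∀ (n : ℕ) (hjn : j + 1 ≤ n) (hnK : n ≤ K), PlaqSmall (24 / 25 * θBal F.L γ b₀ p₀ n) (descendTo F ℰp n K hnK U)) → f U = 0) →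
          ∀ᵐ V ∂(Measure.map (descendTo F ℰp j K hjK) (fieldMeasure (F.P K) 0 ↥(Matrix.specialUnitaryGroup (Fin 2) ℂ))),
            PlaqSmall (θBal F.L γ b₀ p₀ j) V → 0 < c V ∧ ∫ U, f U ∂(σ₀ V) = c V * ∫ z, (J (V, z) : ℝ) * f (Φ (V, z)) ∂τ) := by
  classical
  haveI := hσ₀M
  haveI : BorelSpace (GaugeField (F.P K) 0 ↥(Matrix.specialUnitaryGroup (Fin 2) ℂ)) := T3OrbitAverage.instBorelSpaceGaugeField
  haveI : BorelSpace (GaugeField (F.P j) 0 ↥(Matrix.specialUnitaryGroup (Fin 2) ℂ)) := T3OrbitAverage.instBorelSpaceGaugeField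
  -- abbreviations
  set θj : ℝ := θBal F.L γ b₀ p₀ j with hθj
  set Hf : Measure (GaugeField (F.P K) 0 ↥(Matrix.specialUnitaryGroup (Fin 2) ℂ)) := fieldMeasure (F.P K) 0 ↥(Matrix.specialUnitaryGroup (Fin 2) ℂ) with hHf
  set Hc : Measure (GaugeField (F.P j) 0 ↥(Matrix.specialUnitaryGroup (Fin 2) ℂ)) := fieldMeasure (F.P j) 0 ↥(Matrix.specialUnitaryGroup (Fin 2) ℂ) with hHc
  haveI : IsProbabilityMeasure Hf := Missing.isProbabilityMeasure_fieldMeasure _ _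
  haveI : IsProbabilityMeasure Hc := Missing.isProbabilityMeasure_fieldMeasure _ _
  have hd : Measurable (descendTo F ℰp j K hjK :
      GaugeField (F.P K) 0 ↥(Matrix.specialUnitaryGroup (Fin 2) ℂ) → GaugeField (F.P j) 0 ↥(Matrix.specialUnitaryGroup (Fin 2) ℂ)) :=
    measurable_descendTo F ℰp measurableE_ℰp hjK
  set ν : Measure (GaugeField (F.P j) 0 ↥(Matrix.specialUnitaryGroup (Fin 2) ℂ)) := Hf.map (descendTo F ℰp j K hjK) with hν
  haveI : IsProbabilityMeasure ν := Measure.isProbabilityMeasure_map hd.aemeasurable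
  set W : Set (GaugeField (F.P j) 0 ↥(Matrix.specialUnitaryGroup (Fin 2) ℂ)) := {V | PlaqSmall θj V} with hW
  have hWopen : IsOpen W := by
    have e : W = ⋂ p : Plaq (F.P j) 0, {U | dist1 (GaugeField.plaqHol U p) < θj} := by
      ext U; simp only [hW, PlaqSmall, Set.mem_setOf_eq, Set.mem_iInter]
    rw [e]
    exact isOpen_iInter_of_finite fun p => isOpen_lt (continuous_dist1_plaqHol p) continuous_const
  have hWm : MeasurableSet W := hWopen.measurableSet
  -- the slices of the chart
  have hΦV : ∀ V, Measurable fun z => Φ (V, z) := fun V => hΦ.comp measurable_prodMk_left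
  have hJV : ∀ V, Measurable fun z => J (V, z) := fun V => hJ.comp measurable_prodMk_left
  -- a sup bound for a continuous function on the compact fine space
  have hbdd : ∀ f : GaugeField (F.P K) 0 ↥(Matrix.specialUnitaryGroup (Fin 2) ℂ) → ℝ, Continuous f →
      ∃ C : ℝ, 0 ≤ C ∧ ∀ U, ‖f U‖ ≤ C := by
    intro f hf
    obtain ⟨C, hC⟩ := isCompact_univ.exists_bound_of_continuousOn hf.continuousOn
    exact ⟨max C 0, le_max_right _ _, fun U => (hC U (mem_univ U)).trans (le_max_left _ _)⟩
  refine ⟨?_, ?_⟩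
  · -- (A1-MW) continuity of the fibre integrals on the window (dominated convergence)
    intro f hf hsupp
    obtain ⟨C, hC0, hC⟩ := hbdd f hf
    have hfm : Measurable f := hf.measurable
    have hcont : ContinuousOn (fun V => ∫ z, (J (V, z) : ℝ) * f (Φ (V, z)) ∂τ) W := by
      refine Node00.continuousOn_fibreIntegral_of_dominated (U := W) (Φ := Φ) (J := J) (ρ := f) ?_ (fun z => B z * C)
        (hB.mul_const C) ?_ (hint f hf hsupp)
      · intro V _
        exact ((hJV V).coe_nnreal_real.mul (hfm.comp (hΦV V))).aestronglyMeasurable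
      · intro V hV
        filter_upwards [hJB V hV] with z hz
        rw [norm_mul, Real.norm_eq_abs, abs_of_nonneg (J (V, z)).coe_nonneg]
        exact mul_le_mul hz (hC _) (norm_nonneg _) ((J (V, z)).coe_nonneg.trans hz)
    exact hcont
  · -- (A3-MW) proportionality to the disintegration, with the weight `(dν/dU_j)⁻¹`
    have hac : ν ≪ Hc := absolutelyContinuous_map_descendTo F j K hjK
    have hνeq : Hc.withDensity (ν.rnDeriv Hc) = ν := Measure.withDensity_rnDeriv_eq ν Hc hac
    have hpos : ∀ᵐ V ∂ν, 0 < ν.rnDeriv Hc V := Measure.rnDeriv_pos hac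
    have hltc : ∀ᵐ V ∂Hc, ν.rnDeriv Hc V < ⊤ := Measure.rnDeriv_lt_top ν Hc
    have hlt : ∀ᵐ V ∂ν, ν.rnDeriv Hc V < ⊤ := hac.ae_le hltc
    have hcp : ν ⊗ₘ σ₀ = Hf.map (fun U => (descendTo F ℰp j K hjK U, U)) :=
      compProd_eq_map_graph_of_bind Hf hd σ₀ hbind₀ hfib₀
    refine ⟨fun V => ((ν.rnDeriv Hc V).toReal)⁻¹, fun f hf hf0 => ?_⟩
    obtain ⟨C, hC0, hC⟩ := hbdd f hf
    have hfm : Measurable f := hf.measurable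
    have hfi : Integrable f Hf := integrable_of_continuous_compact hf Hf
    have hS' : ∀ x, f x ≠ 0 → x ∈ S := fun x hx => hS x (by by_contra h; exact hx (hf0 x h))
    -- the fibre mean `I V := ∫ f dσ₀_V`: strongly measurable and bounded
    set I : GaugeField (F.P j) 0 ↥(Matrix.specialUnitaryGroup (Fin 2) ℂ) → ℝ := fun V => ∫ U, f U ∂(σ₀ V) with hI
    have hIm : StronglyMeasurable I := hf.stronglyMeasurable.integral_kernel
    have hIbd : ∀ V, ‖I V‖ ≤ C := by
      intro V
      have h1 := norm_integral_le_of_norm_le_const (μ := σ₀ V) (f := f) (Eventually.of_forall fun U => hC U)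
      simpa using h1
    -- integrability on the window of both candidates
    have hρ₁ : Integrable (fun V => (ν.rnDeriv Hc V).toReal * I V) Hc := by
      have h1 : Integrable (fun V => I V * (ν.rnDeriv Hc V).toReal) Hc :=
        (Measure.integrable_toReal_rnDeriv).bdd_mul hIm.aestronglyMeasurable (Eventually.of_forall hIbd)
      exact h1.congr (Eventually.of_forall fun V => mul_comm _ _)
    have hρ₂ : IntegrableOn (fun V => ∫ z, (J (V, z) : ℝ) * f (Φ (V, z)) ∂τ) W Hc :=
      Node00.integrableOn_fibreIntegral_of_fibredChart (U := W) hΦ hJ hmap hfi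
    -- the test identity
    have key : ∀ g : GaugeField (F.P j) 0 ↥(Matrix.specialUnitaryGroup (Fin 2) ℂ) → ℝ, Measurable g →
        (∃ Cg : ℝ, ∀ V, |g V| ≤ Cg) → (∀ V, V ∉ W → g V = 0) →
        ∫ V, ((ν.rnDeriv Hc V).toReal * I V) * g V ∂Hc = ∫ V, (∫ z, (J (V, z) : ℝ) * f (Φ (V, z)) ∂τ) * g V ∂Hc := by
      intro g hg hCg hg0
      obtain ⟨Cg, hCg'⟩ := hCg
      have h1 := Node00.integral_mul_comp_eq_integral_fibreIntegral_mul (ν := Hf) (μ := Hc) (τ := τ) (U := W) (S := S)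
        (Φ := Φ) (J := J) hWm hd hΦ hJ havgΦ hmap hfi hS' hg ⟨Cg, hCg'⟩ hg0
      rw [← h1]
      -- LHS through the density, the compProd form and the graph map
      have h2 : ∫ V, ((ν.rnDeriv Hc V).toReal * I V) * g V ∂Hc = ∫ V, I V * g V ∂ν := by
        conv_rhs => rw [← hνeq]
        rw [integral_withDensity_eq_integral_toReal_smul (Measure.measurable_rnDeriv _ _) hltc]
        refine integral_congr_ae (Eventually.of_forall fun V => ?_)
        simp only [smul_eq_mul]
        ring
      have hint' : Integrable (fun p : GaugeField (F.P j) 0 ↥(Matrix.specialUnitaryGroup (Fin 2) ℂ) ×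
          GaugeField (F.P K) 0 ↥(Matrix.specialUnitaryGroup (Fin 2) ℂ) => f p.2 * g p.1) (ν ⊗ₘ σ₀) := by
        refine Integrable.mono' (integrable_const (C * Cg))
          ((hfm.comp measurable_snd).mul (hg.comp measurable_fst)).aestronglyMeasurable
          (Eventually.of_forall fun p => ?_)
        rw [norm_mul]
        exact mul_le_mul (hC _) (by simpa [Real.norm_eq_abs] using hCg' p.1) (norm_nonneg _) hC0
      have h3 : ∫ V, I V * g V ∂ν = ∫ p, f p.2 * g p.1 ∂(ν ⊗ₘ σ₀) := by
        rw [Measure.integral_compProd hint']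
        refine integral_congr_ae (Eventually.of_forall fun V => ?_)
        simp only [hI]
        rw [← integral_mul_const]
      have h4 : ∫ p, f p.2 * g p.1 ∂(ν ⊗ₘ σ₀) = ∫ U, f U * g (descendTo F ℰp j K hjK U) ∂Hf := by
        rw [hcp]
        exact integral_map (hd.prodMk measurable_id').aemeasurable
          ((hfm.comp measurable_snd).mul (hg.comp measurable_fst)).aestronglyMeasurable
      rw [h2, h3, h4]
    have hae := Node00.ae_eq_restrict_of_forall_integral_mul_eq hWm hρ₁.integrableOn hρ₂ key
    have hae' : ∀ᵐ V ∂Hc, V ∈ W → (ν.rnDeriv Hc V).toReal * I V = ∫ z, (J (V, z) : ℝ) * f (Φ (V, z)) ∂τ :=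
      (ae_restrict_iff' hWm).1 hae
    filter_upwards [hac.ae_le hae', hpos, hlt] with V hVeq hVpos hVlt
    intro hVW
    have hr : 0 < (ν.rnDeriv Hc V).toReal := ENNReal.toReal_pos hVpos.ne' hVlt.ne
    refine ⟨inv_pos.mpr hr, ?_⟩
    rw [← hVeq hVW, ← mul_assoc, inv_mul_cancel₀ hr.ne', one_mul]


/-! ## §2 (hrep): the σ-fibre mean of LINᵘ-H′ IS the chart ratio at EVERY window point -/

/-- ★★★ **(hrep) THE σ-VERSION EQUALS THE CHART FIBRE MEAN ON THE WINDOW.**  From LINᵘ-H′'s `(σ, mfun)` antecedent (ANY Markov `bind`-disintegration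
`σ` of `dU_K` along `descendTo F ℰp j K`; `mfun` continuous on the window with `mfun V = (∫ a ∂σ V) ∕ (∫ b ∂σ V)` for `dU_j`-a.e. window `V`), the
fibred-chart letters (as §1, plus the (C3) mass letter), continuous `a b` vanishing off the multi-level window MW with `b ≥ 0`, `b > 0` on MW (the knit:
`a = χ·h_{Ts}·ρ′`, `b = χ·ρ′`), and the cut tower's consistency data (`mY ≪ dU_K`, `mY.map d = rj·dU_j`, `rj > 0` on the window — as ✓(L17)∕(L20)∕(L21b)):
`∀ V, PlaqSmall θ_j V → mfun V = (∫ J(V,z)·a(Φ(V,z)) dτ) ∕ (∫ J(V,z)·b(Φ(V,z)) dτ)`.  Route: (A3′) for `a` and `b` (the weight `c V` cancels; the chart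
denominator is positive by (C3) + `b > 0` on MW), `descendTo_* dU_K`-a.e. → `dU_j`-a.e. on the window (✓KNIT `ae_on_of_ae_map_of_ac_of_map_eq`), then EVERY window point by
✓(L21b) `eq_on_window_of_ae` (both sides window-continuous: `mfun` by hypothesis, the chart ratio by (A1′)).
[cite: Balaban1987RG1, (0.11) p.253 and (0.13) p.254; Balaban1985Averaging, (10)-(13) p.19] -/
theorem mfun_eq_chartRatio_on_window
    (F : T3Family) (γ b₀ p₀ : ℝ) (j K : ℕ) (hjK : j ≤ K)
    (σ₀ : Kernel (GaugeField (F.P j) 0 ↥(Matrix.specialUnitaryGroup (Fin 2) ℂ))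
      (GaugeField (F.P K) 0 ↥(Matrix.specialUnitaryGroup (Fin 2) ℂ)))
    (hσ₀M : IsMarkovKernel σ₀)
    (hbind₀ : (Measure.map (descendTo F ℰp j K hjK) (fieldMeasure (F.P K) 0 ↥(Matrix.specialUnitaryGroup (Fin 2) ℂ))).bind ⇑σ₀ =
      fieldMeasure (F.P K) 0 ↥(Matrix.specialUnitaryGroup (Fin 2) ℂ))
    (hfib₀ : ∀ᵐ V ∂(Measure.map (descendTo F ℰp j K hjK) (fieldMeasure (F.P K) 0 ↥(Matrix.specialUnitaryGroup (Fin 2) ℂ))),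
      ∀ᵐ U ∂(σ₀ V), descendTo F ℰp j K hjK U = V)
    {Z : Type*} [MeasurableSpace Z] (τ : Measure Z) [SFinite τ]
    (Φ : GaugeField (F.P j) 0 ↥(Matrix.specialUnitaryGroup (Fin 2) ℂ) × Z → GaugeField (F.P K) 0 ↥(Matrix.specialUnitaryGroup (Fin 2) ℂ))
    (hΦ : Measurable Φ)
    (J : GaugeField (F.P j) 0 ↥(Matrix.specialUnitaryGroup (Fin 2) ℂ) × Z → ℝ≥0) (hJ : Measurable J)
    (S : Set (GaugeField (F.P K) 0 ↥(Matrix.specialUnitaryGroup (Fin 2) ℂ)))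
    (hS : ∀ U, (∀ (n : ℕ) (hjn : j + 1 ≤ n) (hnK : n ≤ K), PlaqSmall (24 / 25 * θBal F.L γ b₀ p₀ n) (descendTo F ℰp n K hnK U)) → U ∈ S)
    (havgΦ : ∀ V ∈ {V | PlaqSmall (θBal F.L γ b₀ p₀ j) V}, ∀ z, descendTo F ℰp j K hjK (Φ (V, z)) = V)
    (hmap : (fieldMeasure (F.P K) 0 ↥(Matrix.specialUnitaryGroup (Fin 2) ℂ)).restrict
        (descendTo F ℰp j K hjK ⁻¹' {V | PlaqSmall (θBal F.L γ b₀ p₀ j) V} ∩ S) =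
      ((((fieldMeasure (F.P j) 0 ↥(Matrix.specialUnitaryGroup (Fin 2) ℂ)).restrict {V | PlaqSmall (θBal F.L γ b₀ p₀ j) V}).prod τ).withDensity
        (fun p => (J p : ℝ≥0∞))).map Φ)
    (hint : ∀ f : GaugeField (F.P K) 0 ↥(Matrix.specialUnitaryGroup (Fin 2) ℂ) → ℝ, Continuous f →
      (∀ U, f U ≠ 0 → ∀ (n : ℕ) (hjn : j + 1 ≤ n) (hnK : n ≤ K), PlaqSmall (24 / 25 * θBal F.L γ b₀ p₀ n) (descendTo F ℰp n K hnK U)) →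
      ∀ᵐ z ∂τ, ContinuousOn (fun V => (J (V, z) : ℝ) * f (Φ (V, z))) {V | PlaqSmall (θBal F.L γ b₀ p₀ j) V})
    (B : Z → ℝ) (hB : Integrable B τ)
    (hJB : ∀ V, PlaqSmall (θBal F.L γ b₀ p₀ j) V → ∀ᵐ z ∂τ, (J (V, z) : ℝ) ≤ B z)
    (hmass : ∀ V, PlaqSmall (θBal F.L γ b₀ p₀ j) V →
      0 < ∫⁻ z in {z | ∀ (n : ℕ) (hjn : j + 1 ≤ n) (hnK : n ≤ K), PlaqSmall (24 / 25 * θBal F.L γ b₀ p₀ n) (descendTo F ℰp n K hnK (Φ (V, z)))},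
        (J (V, z) : ℝ≥0∞) ∂τ)
    (a b : GaugeField (F.P K) 0 ↥(Matrix.specialUnitaryGroup (Fin 2) ℂ) → ℝ) (ha : Continuous a) (hb : Continuous b)
    (ha0 : ∀ U, ¬ (∀ (n : ℕ) (hjn : j + 1 ≤ n) (hnK : n ≤ K), PlaqSmall (24 / 25 * θBal F.L γ b₀ p₀ n) (descendTo F ℰp n K hnK U)) → a U = 0)
    (hb0 : ∀ U, ¬ (∀ (n : ℕ) (hjn : j + 1 ≤ n) (hnK : n ≤ K), PlaqSmall (24 / 25 * θBal F.L γ b₀ p₀ n) (descendTo F ℰp n K hnK U)) → b U = 0)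
    (hbnn : ∀ U, 0 ≤ b U)
    (hbpos : ∀ U, (∀ (n : ℕ) (hjn : j + 1 ≤ n) (hnK : n ≤ K), PlaqSmall (24 / 25 * θBal F.L γ b₀ p₀ n) (descendTo F ℰp n K hnK U)) → 0 < b U)
    (mfun : GaugeField (F.P j) 0 ↥(Matrix.specialUnitaryGroup (Fin 2) ℂ) → ℝ)
    (hmc : ContinuousOn mfun {V | PlaqSmall (θBal F.L γ b₀ p₀ j) V})
    (hmf : ∀ᵐ V ∂(fieldMeasure (F.P j) 0 ↥(Matrix.specialUnitaryGroup (Fin 2) ℂ)), PlaqSmall (θBal F.L γ b₀ p₀ j) V →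
      mfun V = (∫ U, a U ∂(σ₀ V)) / (∫ U, b U ∂(σ₀ V)))
    (mY : Measure (GaugeField (F.P K) 0 ↥(Matrix.specialUnitaryGroup (Fin 2) ℂ)))
    (hmY : mY ≪ fieldMeasure (F.P K) 0 ↥(Matrix.specialUnitaryGroup (Fin 2) ℂ))
    (rj : GaugeField (F.P j) 0 ↥(Matrix.specialUnitaryGroup (Fin 2) ℂ) → ℝ) (hrj : Measurable rj)
    (hrjpos : ∀ V, PlaqSmall (θBal F.L γ b₀ p₀ j) V → 0 < rj V)
    (hcons : mY.map (descendTo F ℰp j K hjK) =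
      (fieldMeasure (F.P j) 0 ↥(Matrix.specialUnitaryGroup (Fin 2) ℂ)).withDensity (fun V => ENNReal.ofReal (rj V))) :
    ∀ V, PlaqSmall (θBal F.L γ b₀ p₀ j) V →
      mfun V = (∫ z, (J (V, z) : ℝ) * a (Φ (V, z)) ∂τ) / (∫ z, (J (V, z) : ℝ) * b (Φ (V, z)) ∂τ) := by
  haveI := hσ₀M
  haveI : BorelSpace (GaugeField (F.P K) 0 ↥(Matrix.specialUnitaryGroup (Fin 2) ℂ)) := T3OrbitAverage.instBorelSpaceGaugeField
  haveI : BorelSpace (GaugeField (F.P j) 0 ↥(Matrix.specialUnitaryGroup (Fin 2) ℂ)) := T3OrbitAverage.instBorelSpaceGaugeField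
  set W : Set (GaugeField (F.P j) 0 ↥(Matrix.specialUnitaryGroup (Fin 2) ℂ)) := {V | PlaqSmall (θBal F.L γ b₀ p₀ j) V} with hW
  have hd : Measurable (descendTo F ℰp j K hjK :
      GaugeField (F.P K) 0 ↥(Matrix.specialUnitaryGroup (Fin 2) ℂ) → GaugeField (F.P j) 0 ↥(Matrix.specialUnitaryGroup (Fin 2) ℂ)) :=
    measurable_descendTo F ℰp measurableE_ℰp hjK
  have hJV : ∀ V, Measurable fun z => J (V, z) := fun V => hJ.comp measurable_prodMk_left
  have hΦV : ∀ V, Measurable fun z => Φ (V, z) := fun V => hΦ.comp measurable_prodMk_left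
  -- support forms
  have ha' : ∀ U, a U ≠ 0 → ∀ (n : ℕ) (hjn : j + 1 ≤ n) (hnK : n ≤ K), PlaqSmall (24 / 25 * θBal F.L γ b₀ p₀ n) (descendTo F ℰp n K hnK U) :=
    fun U hU => by by_contra h; exact hU (ha0 U h)
  have hb' : ∀ U, b U ≠ 0 → ∀ (n : ℕ) (hjn : j + 1 ≤ n) (hnK : n ≤ K), PlaqSmall (24 / 25 * θBal F.L γ b₀ p₀ n) (descendTo F ℰp n K hnK U) :=
    fun U hU => by by_contra h; exact hU (hb0 U h)
  -- §1
  obtain ⟨hA1, c, hA3⟩ := chartIntegrals_descendTo_of_fibredChart F γ b₀ p₀ j K hjK σ₀ hσ₀M hbind₀ hfib₀ τ Φ hΦ J hJ S hS havgΦ hmap hint B hB hJB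
  -- the chart denominator is positive on the window
  obtain ⟨Cb, hCb⟩ := isCompact_univ.exists_bound_of_continuousOn hb.continuousOn
  have hBpos : ∀ V ∈ W, 0 < ∫ z, (J (V, z) : ℝ) * b (Φ (V, z)) ∂τ := by
    intro V hV
    have hgi : Integrable (fun z => (J (V, z) : ℝ) * b (Φ (V, z))) τ := by
      refine (hB.mul_const ‖Cb‖).mono' (((hJV V).coe_nnreal_real).mul (hb.measurable.comp (hΦV V))).aestronglyMeasurable ?_
      filter_upwards [hJB V hV] with z hz
      rw [norm_mul, Real.norm_eq_abs, abs_of_nonneg (J (V, z)).coe_nonneg]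
      exact mul_le_mul hz ((hCb _ (mem_univ _)).trans (Real.norm_eq_abs _ ▸ le_abs_self _)) (norm_nonneg _)
        ((J (V, z)).coe_nonneg.trans hz)
    have hgnn : ∀ z, 0 ≤ (J (V, z) : ℝ) * b (Φ (V, z)) := fun z => mul_nonneg (J (V, z)).coe_nonneg (hbnn _)
    have hnn : 0 ≤ ∫ z, (J (V, z) : ℝ) * b (Φ (V, z)) ∂τ := integral_nonneg hgnn
    rcases hnn.lt_or_eq with hlt | heq
    · exact hlt
    · exfalso
      have h0 : (fun z => (J (V, z) : ℝ) * b (Φ (V, z))) =ᵐ[τ] 0 := (integral_eq_zero_iff_of_nonneg hgnn hgi).mp heq.symm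
      have hJ0 : ∀ᵐ z ∂τ, z ∈ {z | ∀ (n : ℕ) (hjn : j + 1 ≤ n) (hnK : n ≤ K),
          PlaqSmall (24 / 25 * θBal F.L γ b₀ p₀ n) (descendTo F ℰp n K hnK (Φ (V, z)))} → (J (V, z) : ℝ≥0∞) = 0 := by
        filter_upwards [h0] with z hz hzM
        have hb1 : 0 < b (Φ (V, z)) := hbpos _ hzM
        have hprod : (J (V, z) : ℝ) * b (Φ (V, z)) = 0 := hz
        rcases mul_eq_zero.mp hprod with hJz | hbz
        · rw [ENNReal.coe_eq_zero]; exact_mod_cast hJz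
        · exact absurd hbz hb1.ne'
      have hM : MeasurableSet {z | ∀ (n : ℕ) (hjn : j + 1 ≤ n) (hnK : n ≤ K),
          PlaqSmall (24 / 25 * θBal F.L γ b₀ p₀ n) (descendTo F ℰp n K hnK (Φ (V, z)))} :=
        (hΦV V) (measurableSet_multiWindow F γ b₀ p₀ j K)
      have hz : ∫⁻ z in {z | ∀ (n : ℕ) (hjn : j + 1 ≤ n) (hnK : n ≤ K),
          PlaqSmall (24 / 25 * θBal F.L γ b₀ p₀ n) (descendTo F ℰp n K hnK (Φ (V, z)))}, (J (V, z) : ℝ≥0∞) ∂τ = 0 := by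
        rw [← lintegral_zero (μ := τ.restrict _)]
        refine lintegral_congr_ae ?_
        exact (ae_restrict_iff' hM).mpr hJ0
      exact (hmass V hV).ne' hz
  -- a.e. on the window: the σ-ratio is the chart ratio
  have hrat : ∀ᵐ V ∂(Measure.map (descendTo F ℰp j K hjK) (fieldMeasure (F.P K) 0 ↥(Matrix.specialUnitaryGroup (Fin 2) ℂ))),
      V ∈ W → (∫ U, a U ∂(σ₀ V)) / (∫ U, b U ∂(σ₀ V))
        = (∫ z, (J (V, z) : ℝ) * a (Φ (V, z)) ∂τ) / (∫ z, (J (V, z) : ℝ) * b (Φ (V, z)) ∂τ) := by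
    filter_upwards [hA3 a ha ha0, hA3 b hb hb0] with V hVa hVb hVW
    obtain ⟨hc, ea⟩ := hVa hVW
    obtain ⟨-, eb⟩ := hVb hVW
    rw [ea, eb, mul_div_mul_left _ _ hc.ne']
  -- transfer to `dU_j`-a.e. on the window
  have hρX : AEMeasurable (fun V => ENNReal.ofReal (rj V)) (fieldMeasure (F.P j) 0 ↥(Matrix.specialUnitaryGroup (Fin 2) ℂ)) :=
    hrj.ennreal_ofReal.aemeasurable
  have hWne : ∀ V ∈ W, ENNReal.ofReal (rj V) ≠ 0 := fun V hV => (ENNReal.ofReal_pos.mpr (hrjpos V hV)).ne'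
  have hrat' := OrganTangentFibreMeanVersionKnit.ae_on_of_ae_map_of_ac_of_map_eq _ hd _ mY hmY hρX hcons hWne hrat
  have hae : ∀ᵐ V ∂(fieldMeasure (F.P j) 0 ↥(Matrix.specialUnitaryGroup (Fin 2) ℂ)), PlaqSmall (θBal F.L γ b₀ p₀ j) V →
      mfun V = (∫ z, (J (V, z) : ℝ) * a (Φ (V, z)) ∂τ) / (∫ z, (J (V, z) : ℝ) * b (Φ (V, z)) ∂τ) := by
    filter_upwards [hmf, hrat'] with V h1 h2 hV
    rw [h1 hV, h2 hV hV]
  -- both sides are window-continuous ⇒ equal on the window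
  have hcont : ContinuousOn (fun V => (∫ z, (J (V, z) : ℝ) * a (Φ (V, z)) ∂τ) / (∫ z, (J (V, z) : ℝ) * b (Φ (V, z)) ∂τ)) W :=
    (hA1 a ha ha').div (hA1 b hb hb') fun V hV => (hBpos V hV).ne'
  exact OrganTangentFibreMeanTransport.eq_on_window_of_ae (F.P j) 0 (θBal F.L γ b₀ p₀ j) hmc hcont hae

end Summit.QuantumFields.YangMills.Theorems.OrganTangentChartRepresentation

end
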